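import Summits.CriticalPhenomena.SAWScalingLimit.Theorems.SAWDevelopingMapObservableToSLETypeLadderBandDefs
import Summits.CriticalPhenomena.SAWScalingLimit.Theorems.ObservableToSLE.Negative.Identification
import HarnessLib

/-!
# Sanity and non-vacuity of the band-wise renewal vocabulary (research stub `stub_bandRenewal`, r16)

Support file for the crux `Summit.CriticalPhenomena.SAWScalingLimit.Theses.SAWDevelopingMap.ObservableToSLE`
(item stmt-CriticalPhenomena-10472), line `six-class-type-ladder`, skeleton r16.  The skeleton cuts the abundance residue
(item stmt-CriticalPhenomena-17698) through a provable band iteration down to ONE research stub,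

  `stub_bandRenewal : HexObservableLimit → HexTight → HexSimpleSubseqLimits →`
  `    ∀ D a b, IsEmbEndpointApprox hexGraph hexCenter D a b → BandRenewal D a b`,

over the vocabulary of `…TypeLadderBandDefs` (`BandFamily`, `BandSuccess`, `BandBoundAt`, `BandRenewal`, `ZEscape`).
This file records, as machine-checked lemmas, the loophole audit of that vocabulary: the per-band bound `BandBoundAt` is
neither junk-true (vacuous) nor definitionally junk-false.  Nothing here asserts the research statement.

What each lemma certifies:

* `carved_nil_set`, `carvedLaw_empty` (registered carrier `stub_bandSanity_carvedLaw_empty`) — the carved set of the NIL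
  past is `∅`, and carving by `∅` is no carving: `carvedLaw Ω δ ∅ u v = hexSAWLaw Ω δ u v`.  So among the universally
  quantified pasts of `BandBoundAt` the nil past turns the bound into a bound on the UNCONDITIONED critical law.
* `bandBoundAt_nil` — the specialisation of `BandBoundAt` to the nil past, in the shape the band iteration consumes:
  eventually in the mesh, `hexSAWLaw (root δ) (tgt δ) {¬ BandSuccess …} ≤ ofReal c₀` with `c₀ < 1`.
* `bandBoundAt_nonvacuous` — NON-VACUITY (the junk-true test): at an `IsEmbEndpointApprox` pair the critical law is
  eventually a probability measure (`Negative.eventually_isProbabilityMeasure_hexSAWLaw`), hence `BandBoundAt` forces, for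
  all admissible scales and FREQUENTLY in the mesh, an admissible band family TOGETHER WITH a self-avoiding walk from the
  root to the target that succeeds — every admissible family must carry a clean class-`j` window (with fat body and
  `z₀`-escape) that the critical SAW crosses singly with mass `≥ 1 - c₀ > 0`; no designer family makes the failure event
  empty or the law degenerate.
* `ofReal_failureConst_nonpos` — a prover choosing `c₀ ≤ 0` only makes the bound HARDER (`ofReal c₀ = 0` forces the
  failure event to be carved-null for every past); `c₀` is the prover's `∃`, so no loophole there.
* `not_isFirstExitFrom_zero` — `IsFirstExitFrom S l 0 p q` is impossible (the exit index is `≥ 1`), so `BandSuccess` is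
  never witnessed vacuously at index `0`.
* `hexBall_zero` — `hexBall t 0 = {t}`: "exact union of `≤ N` lattice hexagons" is a genuine complexity bound only because
  `N` is chosen BEFORE the mesh (`∃ N, ∀ᶠ δ`); for fixed `δ` any finite set of `≤ N` vertices qualifies.
* `hasCleanWindow_indep_p`, `hasCleanWindow_of_row` — `HasCleanWindow Ω δ ρ S p q` depends on `p` only through the signed
  rows of `p` (indeed only through the row of the witnessing class); with `ClassWindows j` the clause therefore reads "no
  clean window of class `≠ j` anywhere", the intended meaning (two distinct half-lattices cannot agree on a `ρ`-ball once
  `ρ ≫ δ`).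

The audit's informal findings (satisfiability sketch of `BandFamily` eventually in `δ`; the remaining probabilistic content
= a band-wise bridge-level estimate, continuum shadow the void probability of the Alberts–Duminil-Copin 3/4-stable
regenerative set over a band of log-width `log θ`) are recorded in the lead's notes, not here.
-/

noncomputable section

open scoped BigOperators Topology NNReal ENNReal Classical
open Filter Set MeasureTheory Metric
open Literature.Probability.LatticeModels (HexVertex hexGraph hexCenter triZeta Site)
open Literature.Probability.RandomPlanarGeometry
open Literature.Probability.RandomPlanarGeometry.SAW

namespace Summit.CriticalPhenomena.SAWScalingLimit.Theorems.ObservableToSLE.TypeLadder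

open Summit.CriticalPhenomena.SAWScalingLimit.Theorems.ObservableToSLER.BridgeGate
open Summit.CriticalPhenomena.SAWScalingLimit.Theorems.ObservableToSLER.NestedGate

/-! ### The nil past: carving by the empty set -/

/-- The carved set of the nil past (the past vertices other than the tip) is empty. -/
theorem carved_nil_set {G : SimpleGraph HexVertex} (r : HexVertex) :
    {v : HexVertex | v ∈ (SimpleGraph.Walk.nil : G.Walk r r).support ∧ v ≠ r} = ∅ := by
  ext v
  simp

/-- Carving by the empty set is no carving: the carved law is the critical law itself. -/
theorem carvedLaw_empty (Ω : Set ℂ) (δ : ℝ) (u v : HexVertex) :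
    carvedLaw Ω δ (∅ : Set HexVertex) u v = hexSAWLaw Ω δ u v := by
  have h : carvedWeight Ω δ (∅ : Set HexVertex) u v = hexSAWWeight Ω δ u v := by
    have hs : {γ : HexDomainSAW Ω δ u v | ∀ x ∈ γ.walk.support, x ∉ (∅ : Set HexVertex)} = Set.univ := by
      ext γ
      simp
    rw [carvedWeight, hs, Measure.restrict_univ]
  rw [carvedLaw, h]
  rfl

/-- Registered carrier `stub_bandSanity_carvedLaw_empty` (crux item stmt-CriticalPhenomena-10472, skeleton r16; carrier of
this sanity file): **carving by the empty set is no carving** — for every domain, mesh and pair of endpoints the carved law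
with empty removed set is the critical hexagonal SAW law itself, `carvedLaw Ω δ ∅ u v = hexSAWLaw Ω δ u v`.  This is the
fact that makes the nil past an honest test case of the per-band bound `BandBoundAt`. -/
theorem stub_bandSanity_carvedLaw_empty :
    ∀ (Ω : Set ℂ) (δ : ℝ) (u v : HexVertex), carvedLaw Ω δ (∅ : Set HexVertex) u v = hexSAWLaw Ω δ u v :=
  fun Ω δ u v => carvedLaw_empty Ω δ u v

/-! ### The per-band bound at the nil past, and its non-vacuity -/

/-- The specialisation of `BandBoundAt` to the NIL past: eventually in the mesh, the UNCONDITIONED critical law gives the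
failure of band success of `root δ :: (future).tail` mass `≤ c₀ < 1`.  (So the bound has content as soon as `hexSAWLaw` is a
probability measure, which `IsEmbEndpointApprox.reachable` + finiteness of `Ω_δ` give eventually; see
`bandBoundAt_nonvacuous`.) -/
theorem bandBoundAt_nil {D : DobrushinDomain} {root tgt : ℝ → HexVertex} {w z₀ : ℂ} {j : Fin 6}
    (h : BandBoundAt D root tgt w z₀ j) :
    ∃ c₀ < (1 : ℝ), ∃ θ > (1 : ℝ), ∃ R₂ > (0 : ℝ), ∀ R ∈ Set.Ioc (0 : ℝ) R₂, ∀ P ∈ Set.Ioc (0 : ℝ) R,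
      ∀ ρin ∈ Set.Ioc (0 : ℝ) (P / (2 * θ)), ∃ ρw > (0 : ℝ), ∀ ρ ∈ Set.Ioc (0 : ℝ) ρw, ∃ N : ℕ,
        ∀ᶠ δ : ℝ in 𝓝[>] 0,
          ∃ S : ℕ → Set HexVertex, BandFamily D.carrier δ ρin (θ * ρin) ρ (2 * R) z₀ w N j (root δ) S ∧
            hexSAWLaw D.carrier δ (root δ) (tgt δ)
                {η | ¬ BandSuccess D.carrier δ ρ P S (root δ) (root δ :: η.walk.support.tail)} ≤
              ENNReal.ofReal c₀ := by
  obtain ⟨c₀, hc₀, θ, hθ, R₂, hR₂, H⟩ := h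
  refine ⟨c₀, hc₀, θ, hθ, R₂, hR₂, fun R hR P hP ρin hρin => ?_⟩
  obtain ⟨ρw, hρw, H1⟩ := H R hR P hP ρin hρin
  refine ⟨ρw, hρw, fun ρ hρ => ?_⟩
  obtain ⟨N, hN⟩ := H1 ρ hρ
  refine ⟨N, hN.mono fun δ hδ => ?_⟩
  obtain ⟨S, hS, hb⟩ := hδ
  refine ⟨S, hS, ?_⟩
  have hnil := hb (root δ) SimpleGraph.Walk.nil SimpleGraph.Walk.IsPath.nil (by
    intro v hv
    simp only [SimpleGraph.Walk.support_nil, List.mem_singleton] at hv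
    subst hv
    simp only [dist_self]
    exact hρin.1.le)
  rw [carved_nil_set, carvedLaw_empty] at hnil
  simpa using hnil

/-- **Non-vacuity.**  If the per-band bound holds at an endpoint-approximating pair, then for all admissible scales,
frequently in the mesh, some admissible band family admits a SUCCEEDING self-avoiding walk from the root to the target (nil
past): the failure event has unconditioned mass `≤ c₀ < 1 = total mass`. -/
theorem bandBoundAt_nonvacuous {D : DobrushinDomain} {root tgt : ℝ → HexVertex} {w z₀ : ℂ} {j : Fin 6}
    (h : BandBoundAt D root tgt w z₀ j) (hab : IsEmbEndpointApprox hexGraph hexCenter D root tgt) :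
    ∃ θ > (1 : ℝ), ∃ R₂ > (0 : ℝ), ∀ R ∈ Set.Ioc (0 : ℝ) R₂, ∀ P ∈ Set.Ioc (0 : ℝ) R,
      ∀ ρin ∈ Set.Ioc (0 : ℝ) (P / (2 * θ)), ∃ ρw > (0 : ℝ), ∀ ρ ∈ Set.Ioc (0 : ℝ) ρw, ∃ N : ℕ,
        ∃ᶠ δ : ℝ in 𝓝[>] 0,
          ∃ S : ℕ → Set HexVertex, BandFamily D.carrier δ ρin (θ * ρin) ρ (2 * R) z₀ w N j (root δ) S ∧
            ∃ η : HexDomainSAW D.carrier δ (root δ) (tgt δ),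
              BandSuccess D.carrier δ ρ P S (root δ) (root δ :: η.walk.support.tail) := by
  obtain ⟨c₀, hc₀, θ, hθ, R₂, hR₂, H⟩ := bandBoundAt_nil h
  refine ⟨θ, hθ, R₂, hR₂, fun R hR P hP ρin hρin => ?_⟩
  obtain ⟨ρw, hρw, H1⟩ := H R hR P hP ρin hρin
  refine ⟨ρw, hρw, fun ρ hρ => ?_⟩
  obtain ⟨N, hN⟩ := H1 ρ hρ
  refine ⟨N, ?_⟩
  have hprob := Summit.CriticalPhenomena.SAWScalingLimit.Theorems.ObservableToSLE.Negative.eventually_isProbabilityMeasure_hexSAWLaw hab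
  refine (hN.and hprob).frequently.mono fun δ ⟨⟨S, hS, hb⟩, hP'⟩ => ⟨S, hS, ?_⟩
  by_contra hnone
  push Not at hnone
  have huniv : {η : HexDomainSAW D.carrier δ (root δ) (tgt δ) |
      ¬ BandSuccess D.carrier δ ρ P S (root δ) (root δ :: η.walk.support.tail)} = Set.univ := by
    ext η
    simp only [Set.mem_setOf_eq, Set.mem_univ, iff_true]
    exact hnone η
  rw [huniv, measure_univ] at hb
  have : (1 : ℝ≥0∞) ≤ ENNReal.ofReal c₀ := hb
  rw [ENNReal.one_le_ofReal] at this
  linarith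

/-- A non-positive failure constant truncates to `0` and forces the failure event to be null: if `c₀ ≤ 0` then a bound
`μ E ≤ ENNReal.ofReal c₀` (the shape of the conclusion of `BandBoundAt`, for any carved law `μ`) says `μ E = 0`.  Choosing
`c₀ ≤ 0` thus only makes the per-band bound HARDER; `c₀` is the prover's `∃`, so this is no loophole. -/
theorem ofReal_failureConst_nonpos {α : Type*} [MeasurableSpace α] {μ : Measure α} {E : Set α} {c₀ : ℝ}
    (hc : c₀ ≤ 0) (h : μ E ≤ ENNReal.ofReal c₀) : ENNReal.ofReal c₀ = 0 ∧ μ E = 0 := by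
  have h0 : ENNReal.ofReal c₀ = 0 := ENNReal.ofReal_eq_zero.2 hc
  exact ⟨h0, nonpos_iff_eq_zero.1 (h.trans_eq h0)⟩

/-! ### First exits, lattice hexagons, clean windows -/

/-- The exit index of a first exit is `≥ 1`: `IsFirstExitFrom S l 0 p q` is impossible (the exit vertex `p` would be the
last entry of the empty prefix).  So `BandSuccess` is never witnessed at index `0`. -/
theorem not_isFirstExitFrom_zero (S : Set HexVertex) (l : List HexVertex) (p q : HexVertex) :
    ¬ IsFirstExitFrom S l 0 p q := by
  rintro ⟨h, -⟩
  simp at h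

/-- The trivial lattice hexagon is its centre, `hexBall t 0 = {t}` (set form of `mem_hexBall_zero_iff` of
`…TypeLadderCarvedReductionSqueezeLevelLimits`, not imported here).  Hence "exact union of `≤ N` lattice hexagons" in
`BandFamily` bounds the complexity of a level only because `N` is fixed BEFORE the mesh (`∃ N, ∀ᶠ δ`). -/
theorem hexBall_zero (t : HexVertex) : hexBall t 0 = {t} := by
  ext v
  simp only [hexBall, Nat.cast_zero, Set.mem_setOf_eq, Set.mem_singleton_iff, abs_nonpos_iff, sub_eq_zero]
  constructor
  · intro h
    have h0 := h 0
    have h1 := h 1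
    have h2 := h 2
    simp only [rowCoord, Fin.isValue, ↓reduceIte, one_ne_zero, Fin.reduceEq] at h0 h1 h2
    obtain ⟨x, s⟩ := v
    obtain ⟨y, s'⟩ := t
    simp only at h0 h1 h2
    have hs : (s : ℕ) = s' := by omega
    have hx : x = y := by
      ext i
      fin_cases i
      · exact h1
      · exact h0
    rw [hx, Fin.ext hs]
  · rintro rfl i
    rfl

/-- `HasCleanWindow` sees `p` only through its signed rows: any `p'` with the same six signed rows gives the same window.
(In particular `p` need not be adjacent to `q`; combined with `ClassWindows j` the clause says: no clean window of class
`≠ j` exists anywhere, since for `k ≠ j` some `p'` in the same `k`-row has a different `j`-row.) -/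
theorem hasCleanWindow_indep_p {Ω : Set ℂ} {δ ρ : ℝ} {S : Set HexVertex} {p p' q : HexVertex}
    (h : HasCleanWindow Ω δ ρ S p q) (hp : ∀ k : Fin 6, rowOf k p' = rowOf k p) :
    HasCleanWindow Ω δ ρ S p' q := by
  obtain ⟨hball, k, hk, hS⟩ := h
  exact ⟨hball, k, by rw [hp]; exact hk, fun x hx => by rw [hp]; exact hS x hx⟩

/-- Sharper: only the `k`-row of `p` matters for a class-`k` reading of the window — a window ball inside `Ω` about the
rescaled `q`, with `q` one `k`-row above `p` and `S` the exact lower `k`-half-lattice `{rowOf k · ≤ rowOf k p}` inside the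
ball, is a clean window `HasCleanWindow Ω δ ρ S p' q` for EVERY `p'` in the `k`-row of `p`. -/
theorem hasCleanWindow_of_row {Ω : Set ℂ} {δ ρ : ℝ} {S : Set HexVertex} {p p' q : HexVertex} {k : Fin 6}
    (hball : closedBall ((δ : ℂ) * hexCenter q) ρ ⊆ Ω) (hk : rowOf k q = rowOf k p + 1)
    (hS : ∀ x : HexVertex, (δ : ℂ) * hexCenter x ∈ ball ((δ : ℂ) * hexCenter q) ρ → (x ∈ S ↔ rowOf k x ≤ rowOf k p))
    (hp : rowOf k p' = rowOf k p) : HasCleanWindow Ω δ ρ S p' q :=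
  ⟨hball, k, by rw [hp]; exact hk, fun x hx => by rw [hp]; exact hS x hx⟩

end Summit.CriticalPhenomena.SAWScalingLimit.Theorems.ObservableToSLE.TypeLadder

end
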